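import Mathlib
import HarnessLib
import Summits.HubbardSuperconductivity.HubbardSuperconductivity.Theorems.KLProgrammeKLRegimeTwoVolumeLipTowerDefs

/-!
# Route `KLProgramme` — crux K3 ENGINE (stmt-HubbardSuperconductivity-20437), stub (e) proof-input «(e)-D-ROWS», (M1)/F-D3′ (sequel): THE TWO-VOLUME
# DIFFERENCES OF THE LIPSCHITZ TOWER, THE DEPTH SETS AND THE DEEP-PIN DATA (definitions; seat hubbard-kl-k3c4-p1 g23; `--supports` 20437; DROWS-SCOPE-g22 §7.2, §8)

Sequel of `…TwoVolumeLipTowerDefs` (one-volume objects `klLipInput`/`klLipBorn` = sector preimages of E1's block input / increment, block glue `klGlue` over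
`klBlockEquiv`).  Here, at the COMMON frame `K` of the fine torus `b·L` and the coarse torus `L`:

* §3 the two-volume DIFFERENCES: **`klLipInputDiff L b M β U μ K d k := klLipInput (bL) … − klGlue (klLipInput L …)`** (the measured difference; T3-Lip₄'s
  `dμ k ·` is its unweighted deep-pin supremum in law units) and **`klLipBornDiff … := klLipBorn (bL) … − klGlue (klLipBorn L …)`** (the born difference, `db k ·`);
  `klLipInput_fine_eq` (`fine = glue coarse + difference`, the `V + D` of the deep-pin doors); parity / constant-part rows.
* §4 DEPTH and the deep-pin data: **`klDeepPins L R`** (the `R`-deep labels, `∀ j, R ≤ x⃗_j mod L ∧ x⃗_j mod L + R < L` — the form of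
  `…TwoVolumeTorusBlocks.far_of_not_deep_of_deep`, `…TwoVolumeLipZoneGeometry.klScaleWt_ge_of_deep_of_not_deep`; a `Finset`, so membership is decidable for the
  support split of the deep-pin doors), `klDeepPins_mono`; the UNWEIGHTED deep-pin suprema **`klLipInputDiffSup … d k m R`**, **`klLipBornDiffSup … d k m R`** (`⨆` over
  (slot, `R`-deep pin) of the pinned `L¹` sums — E1's `klTowerBornWt` construction; `0` on an empty index) with their `le` / nonnegativity / antitonicity rows — the
  currency of DROWS-SCOPE-g22 §7.2 (difference data unweighted at deep pins; majorants = the one-volume laws).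

Definitions with bodies and `rfl`/order rows only; nothing about the model is asserted; nothing asserts the (D) rows, stub (e), VL, K3 or superconductivity.
References: BGM 2006 §2.8, §3 (3.2)–(3.8) [cite: BenfattoGiulianiMastropietro2006]; Gawȩdzki–Kupiainen 1985 §3.
-/

noncomputable section

namespace Summit.HubbardSuperconductivity.HubbardSuperconductivity.Theorems.TwoVolumeLip

set_option linter.dupNamespace false -- summit = problem name (single-conjunct summit), D-0017

open Finset Literature.MathematicalPhysics.QuantumLattice GrassmannAlgebra Literature.Probability.LatticeModels
  Literature.Probability.LatticeModels.BattleFederbush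
open Literature.MathematicalPhysics.QuantumLattice.FermiRG
open Summit.HubbardSuperconductivity.HubbardSuperconductivity.Theorems.KLRegimeSplit
open Summit.HubbardSuperconductivity.HubbardSuperconductivity.Theorems.KLProgrammeLegKernels
open Summit.HubbardSuperconductivity.HubbardSuperconductivity.Theorems.DispersionFlow
open Summit.HubbardSuperconductivity.HubbardSuperconductivity.Theorems.EngineV8
open Summit.HubbardSuperconductivity.HubbardSuperconductivity.Theorems.TwoVolumeSource
open Summit.HubbardSuperconductivity.HubbardSuperconductivity.Theorems.TwoVolumeDefect

/-! ## §3 The two-volume differences at the common frame -/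

section Differences

variable (L b M : ℕ) [NeZero L] [NeZero (b * L)]

/-- **`klLipInputDiff L b M β U μ K d k`** — the MEASURED two-volume difference of block `k` at the common frame `K`: the fine volume's analysed input minus the
glued coarse one, `klLipInput (bL) … d k − klGlue (klLipInput L … d k)` (T3-Lip₄'s `dμ k ·` is its unweighted deep-pin supremum in law units). -/
def klLipInputDiff (β U μ : ℝ) (K : TrigPolyC4v) (d k : ℕ) :
    GrassmannAlgebra ℂ (SpaceTimeIdx (b * L) M × SectorLeg (sectorCount (d * k - 1))) :=
  klLipInput (b * L) M β U μ K d k - klGlue L b M (sectorCount (d * k - 1)) (klLipInput L M β U μ K d k)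

/-- **`klLipBornDiff L b M β U μ K d k`** — the BORN two-volume difference of block `k` at the common frame `K`: the fine volume's analysed born increment minus
the glued coarse one, `klLipBorn (bL) … d k − klGlue (klLipBorn L … d k)` (T3-Lip₄'s `db k ·` before units). -/
def klLipBornDiff (β U μ : ℝ) (K : TrigPolyC4v) (d k : ℕ) :
    GrassmannAlgebra ℂ (SpaceTimeIdx (b * L) M × SectorLeg (sectorCount (d * k))) :=
  klLipBorn (b * L) M β U μ K d k - klGlue L b M (sectorCount (d * k)) (klLipBorn L M β U μ K d k)

variable {L b M}

/-- Unfolding `klLipInputDiff`. -/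
theorem klLipInputDiff_def (β U μ : ℝ) (K : TrigPolyC4v) (d k : ℕ) :
    klLipInputDiff L b M β U μ K d k =
      klLipInput (b * L) M β U μ K d k - klGlue L b M (sectorCount (d * k - 1)) (klLipInput L M β U μ K d k) := rfl

/-- Unfolding `klLipBornDiff`. -/
theorem klLipBornDiff_def (β U μ : ℝ) (K : TrigPolyC4v) (d k : ℕ) :
    klLipBornDiff L b M β U μ K d k =
      klLipBorn (b * L) M β U μ K d k - klGlue L b M (sectorCount (d * k)) (klLipBorn L M β U μ K d k) := rfl

/-- `fine input = glued coarse input + measured difference` (the `V + D` of the deep-pin doors). -/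
theorem klLipInput_fine_eq (β U μ : ℝ) (K : TrigPolyC4v) (d k : ℕ) :
    klLipInput (b * L) M β U μ K d k = klGlue L b M (sectorCount (d * k - 1)) (klLipInput L M β U μ K d k) + klLipInputDiff L b M β U μ K d k := by
  rw [klLipInputDiff, add_sub_cancel]

/-- The measured difference is even when both inputs are. -/
theorem klLipInputDiff_mem_evenOdd_zero {β U μ : ℝ} {K : TrigPolyC4v} {d k : ℕ}
    (hf : klTowerInput (b * L) M β U μ K d k ∈ evenOdd ℂ 0) (hc : klTowerInput L M β U μ K d k ∈ evenOdd ℂ 0) :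
    klLipInputDiff L b M β U μ K d k ∈ evenOdd ℂ 0 :=
  sub_mem (klLipInput_mem_evenOdd_zero hf) (klGlue_mem_evenOdd_zero (klLipInput_mem_evenOdd_zero hc))

/-- The born difference is even when both increments are. -/
theorem klLipBornDiff_mem_evenOdd_zero {β U μ : ℝ} {K : TrigPolyC4v} {d k : ℕ}
    (hf : klTowerIncr (b * L) M β U μ K d k ∈ evenOdd ℂ 0) (hc : klTowerIncr L M β U μ K d k ∈ evenOdd ℂ 0) :
    klLipBornDiff L b M β U μ K d k ∈ evenOdd ℂ 0 :=
  sub_mem (klLipBorn_mem_evenOdd_zero hf) (klGlue_mem_evenOdd_zero (klLipBorn_mem_evenOdd_zero hc))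

/-- The measured difference has no constant part when the inputs have none. -/
theorem constPart_klLipInputDiff {β U μ : ℝ} {K : TrigPolyC4v} {d k : ℕ}
    (hf : constPart ℂ (klTowerInput (b * L) M β U μ K d k) = 0) (hc : constPart ℂ (klTowerInput L M β U μ K d k) = 0) :
    constPart ℂ (klLipInputDiff L b M β U μ K d k) = 0 := by
  rw [klLipInputDiff, map_sub, constPart_klLipInput, hf, constPart_klGlue (by rw [constPart_klLipInput, hc]), sub_zero]

/-- The born difference has no constant part when the increments have none. -/
theorem constPart_klLipBornDiff {β U μ : ℝ} {K : TrigPolyC4v} {d k : ℕ}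
    (hf : constPart ℂ (klTowerIncr (b * L) M β U μ K d k) = 0) (hc : constPart ℂ (klTowerIncr L M β U μ K d k) = 0) :
    constPart ℂ (klLipBornDiff L b M β U μ K d k) = 0 := by
  rw [klLipBornDiff, map_sub, constPart_klLipBorn, hf, constPart_klGlue (by rw [constPart_klLipBorn, hc]), sub_zero]

end Differences

/-! ## §4 Depth and the unweighted deep-pin data -/

section Depth

variable {V M N : ℕ} [NeZero V]

/-- **`klDeepPins L R`** — the `R`-DEEP labels of the fine torus tiled by boxes of side `L`: every coordinate of the site is at distance `≥ R` from the seams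
(`R ≤ x⃗_j mod L` and `x⃗_j mod L + R < L`, the form of `…TwoVolumeTorusBlocks.far_of_not_deep_of_deep`).  A `Finset`, so that `(· ∈ klDeepPins L R)` is a
decidable predicate for the support split of the deep-pin doors. -/
def klDeepPins (L R : ℕ) : Finset (SpaceTimeIdx V M × SectorLeg N) :=
  univ.filter fun x : SpaceTimeIdx V M × SectorLeg N => ∀ j : Fin 2, R ≤ (x.1.2 j).val % L ∧ (x.1.2 j).val % L + R < L

/-- Membership in `klDeepPins`. -/
theorem mem_klDeepPins {L R : ℕ} {x : SpaceTimeIdx V M × SectorLeg N} :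
    x ∈ klDeepPins L R ↔ ∀ j : Fin 2, R ≤ (x.1.2 j).val % L ∧ (x.1.2 j).val % L + R < L := by
  simp only [klDeepPins, mem_filter, mem_univ, true_and]

/-- Deeper labels are deep: `R′ ≤ R` ⇒ `klDeepPins L R ⊆ klDeepPins L R′`. -/
theorem klDeepPins_mono {L R R' : ℕ} (h : R' ≤ R) : (klDeepPins L R : Finset (SpaceTimeIdx V M × SectorLeg N)) ⊆ klDeepPins L R' := by
  intro x hx
  rw [mem_klDeepPins] at hx ⊢
  exact fun j => ⟨h.trans (hx j).1, by have := (hx j).2; omega⟩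

/-- Depth only depends on the site. -/
theorem mem_klDeepPins_of_site_eq {L R : ℕ} {x y : SpaceTimeIdx V M × SectorLeg N} (h : x.1.2 = y.1.2) (hx : x ∈ klDeepPins L R) :
    y ∈ klDeepPins L R := by
  rw [mem_klDeepPins] at hx ⊢
  exact fun j => by rw [← h]; exact hx j

end Depth

section DeepData

variable (L b M : ℕ) [NeZero L] [NeZero (b * L)]

/-- **`klLipInputDiffSup L b M β U μ K d k m R`** — the UNWEIGHTED deep-pin size of the measured difference of block `k` in degree `m`: the supremum over the
slots `q` and the `R`-deep fine pins `w` of `Σ_{X : X_q = w} ‖kernel (klLipInputDiff …) m X‖` (`0` if there is no deep pin or `m = 0`). -/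
def klLipInputDiffSup (β U μ : ℝ) (K : TrigPolyC4v) (d k m R : ℕ) : ℝ :=
  ⨆ qw : Fin m × {w : SpaceTimeIdx (b * L) M × SectorLeg (sectorCount (d * k - 1)) // w ∈ klDeepPins L R},
    ∑ X ∈ univ.filter (fun X : Fin m → SpaceTimeIdx (b * L) M × SectorLeg (sectorCount (d * k - 1)) => X qw.1 = qw.2.1),
      ‖kernel ℂ (klLipInputDiff L b M β U μ K d k) m X‖

/-- **`klLipBornDiffSup L b M β U μ K d k m R`** — the UNWEIGHTED deep-pin size of the born difference of block `k` in degree `m`: the supremum over the slots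
`q` and the `R`-deep fine pins `w` of `Σ_{X : X_q = w} ‖kernel (klLipBornDiff …) m X‖`. -/
def klLipBornDiffSup (β U μ : ℝ) (K : TrigPolyC4v) (d k m R : ℕ) : ℝ :=
  ⨆ qw : Fin m × {w : SpaceTimeIdx (b * L) M × SectorLeg (sectorCount (d * k)) // w ∈ klDeepPins L R},
    ∑ X ∈ univ.filter (fun X : Fin m → SpaceTimeIdx (b * L) M × SectorLeg (sectorCount (d * k)) => X qw.1 = qw.2.1),
      ‖kernel ℂ (klLipBornDiff L b M β U μ K d k) m X‖

variable {L b M}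

/-- Every pinned sum of the measured difference at an `R`-deep pin is at most the deep-pin size. -/
theorem sum_pinned_norm_kernel_inputDiff_le_sup (β U μ : ℝ) (K : TrigPolyC4v) (d k m R : ℕ) (q : Fin m)
    {w : SpaceTimeIdx (b * L) M × SectorLeg (sectorCount (d * k - 1))} (hw : w ∈ klDeepPins L R) :
    ∑ X ∈ univ.filter (fun X : Fin m → SpaceTimeIdx (b * L) M × SectorLeg (sectorCount (d * k - 1)) => X q = w),
        ‖kernel ℂ (klLipInputDiff L b M β U μ K d k) m X‖ ≤ klLipInputDiffSup L b M β U μ K d k m R :=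
  le_ciSup (f := fun qw : Fin m × {w : SpaceTimeIdx (b * L) M × SectorLeg (sectorCount (d * k - 1)) // w ∈ klDeepPins L R} =>
    ∑ X ∈ univ.filter (fun X : Fin m → SpaceTimeIdx (b * L) M × SectorLeg (sectorCount (d * k - 1)) => X qw.1 = qw.2.1),
      ‖kernel ℂ (klLipInputDiff L b M β U μ K d k) m X‖) (Set.finite_range _).bddAbove (q, ⟨w, hw⟩)

/-- Every pinned sum of the born difference at an `R`-deep pin is at most the deep-pin size. -/
theorem sum_pinned_norm_kernel_bornDiff_le_sup (β U μ : ℝ) (K : TrigPolyC4v) (d k m R : ℕ) (q : Fin m)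
    {w : SpaceTimeIdx (b * L) M × SectorLeg (sectorCount (d * k))} (hw : w ∈ klDeepPins L R) :
    ∑ X ∈ univ.filter (fun X : Fin m → SpaceTimeIdx (b * L) M × SectorLeg (sectorCount (d * k)) => X q = w),
        ‖kernel ℂ (klLipBornDiff L b M β U μ K d k) m X‖ ≤ klLipBornDiffSup L b M β U μ K d k m R :=
  le_ciSup (f := fun qw : Fin m × {w : SpaceTimeIdx (b * L) M × SectorLeg (sectorCount (d * k)) // w ∈ klDeepPins L R} =>
    ∑ X ∈ univ.filter (fun X : Fin m → SpaceTimeIdx (b * L) M × SectorLeg (sectorCount (d * k)) => X qw.1 = qw.2.1),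
      ‖kernel ℂ (klLipBornDiff L b M β U μ K d k) m X‖) (Set.finite_range _).bddAbove (q, ⟨w, hw⟩)

/-- The deep-pin size of the measured difference is nonnegative. -/
theorem klLipInputDiffSup_nonneg (β U μ : ℝ) (K : TrigPolyC4v) (d k m R : ℕ) : 0 ≤ klLipInputDiffSup L b M β U μ K d k m R := by
  unfold klLipInputDiffSup
  rcases isEmpty_or_nonempty (Fin m × {w : SpaceTimeIdx (b * L) M × SectorLeg (sectorCount (d * k - 1)) // w ∈ klDeepPins L R}) with h | h
  · rw [Real.iSup_of_isEmpty]
  · exact le_ciSup_of_le (Set.finite_range _).bddAbove (Classical.arbitrary _) (sum_nonneg fun _ _ => norm_nonneg _)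

/-- The deep-pin size of the born difference is nonnegative. -/
theorem klLipBornDiffSup_nonneg (β U μ : ℝ) (K : TrigPolyC4v) (d k m R : ℕ) : 0 ≤ klLipBornDiffSup L b M β U μ K d k m R := by
  unfold klLipBornDiffSup
  rcases isEmpty_or_nonempty (Fin m × {w : SpaceTimeIdx (b * L) M × SectorLeg (sectorCount (d * k)) // w ∈ klDeepPins L R}) with h | h
  · rw [Real.iSup_of_isEmpty]
  · exact le_ciSup_of_le (Set.finite_range _).bddAbove (Classical.arbitrary _) (sum_nonneg fun _ _ => norm_nonneg _)

/-- Monotonicity in the depth: a larger `R` restricts the pins, so the size does not increase. -/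
theorem klLipInputDiffSup_anti (β U μ : ℝ) (K : TrigPolyC4v) (d k m : ℕ) {R R' : ℕ} (h : R ≤ R') :
    klLipInputDiffSup L b M β U μ K d k m R' ≤ klLipInputDiffSup L b M β U μ K d k m R := by
  unfold klLipInputDiffSup
  rcases isEmpty_or_nonempty (Fin m × {w : SpaceTimeIdx (b * L) M × SectorLeg (sectorCount (d * k - 1)) // w ∈ klDeepPins L R'}) with h' | h'
  · rw [Real.iSup_of_isEmpty]
    exact klLipInputDiffSup_nonneg β U μ K d k m R
  · refine ciSup_le fun qw => ?_
    exact sum_pinned_norm_kernel_inputDiff_le_sup β U μ K d k m R qw.1 (klDeepPins_mono h qw.2.2)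

/-- Monotonicity in the depth for the born difference. -/
theorem klLipBornDiffSup_anti (β U μ : ℝ) (K : TrigPolyC4v) (d k m : ℕ) {R R' : ℕ} (h : R ≤ R') :
    klLipBornDiffSup L b M β U μ K d k m R' ≤ klLipBornDiffSup L b M β U μ K d k m R := by
  unfold klLipBornDiffSup
  rcases isEmpty_or_nonempty (Fin m × {w : SpaceTimeIdx (b * L) M × SectorLeg (sectorCount (d * k)) // w ∈ klDeepPins L R'}) with h' | h'
  · rw [Real.iSup_of_isEmpty]
    exact klLipBornDiffSup_nonneg β U μ K d k m R
  · refine ciSup_le fun qw => ?_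
    exact sum_pinned_norm_kernel_bornDiff_le_sup β U μ K d k m R qw.1 (klDeepPins_mono h qw.2.2)

end DeepData

end Summit.HubbardSuperconductivity.HubbardSuperconductivity.Theorems.TwoVolumeLip

end
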